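import Summits.Ventures.PercRepro.C025ProfileGen
import Summits.Ventures.PercRepro.C025ProfileHallTop
import Summits.Ventures.PercRepro.C025ProfileRowReduction

/-!
# THE ROW (2,3) OF THE HALL FORM (H⁺) FOR EVERY FINITE MATROID AND EVERY FAMILY (night-3 g8)

The certificate of `C025ProfileGen` is LOCAL: `Σ_{S ⊇ B} wgn ≥ ρ(E∖B)` for every rank-`2` set `B` and
`Σ_{B ⊆ S} wgn ≤ 3` for every rank-`3` set `S`. Restricting the double count to a sub-family `𝒜` of rank-`2` sets only
drops nonnegative terms on the capacity side, so the same (Cap) and (Dem) give the Hall form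
`Σ_{B ∈ 𝒜} price(B) ≤ #{S : ρ(S) = 3, ∃ B ∈ 𝒜, B ⊆ S}` (`hallIneq_two_three_of_certG`). Rank `≤ 2`: every price is
`0` (`hallIneq_of_eRank_lt`); rank `3`: the tree's `hallIneq_top`; the tree's `hallIneq_two_three_of_simple` reduces
every matroid to the simple ones: **`hallIneq_two_three`** — `(H⁺_{2,3})` for every finite matroid and every family, the
row `(2,3)` of C-033.
-/

open scoped Matroid

namespace PercRepro

open Set Finset ThmH

section GenHall

variable {α : Type} [DecidableEq α] {M : Matroid α} [M.Finite]

/-- **The double count for a family**: (Cap) and (Dem) for `wgn` on `M` give `(H⁺_{2,3})` on `M`. -/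
theorem hallIneq_two_three_of_certG
    (hCap : ∀ S ∈ Shadow.levelSet M 3, ∑ B ∈ (Profile.Rq M 2).filter (fun B => B ⊆ S), wgn M B S ≤ 3)
    (hDem : ∀ B ∈ Profile.Rq M 2, 3 ≤ crk M B →
      (crk M B : ℚ) ≤ ∑ S ∈ (Shadow.levelSet M 3).filter (fun S => B ⊆ S), wgn M B S) :
    Profile.HallIneq M 2 3 := by
  classical
  intro 𝒜 h𝒜
  have hswap : ∑ B ∈ 𝒜, ∑ S ∈ (Shadow.levelSet M 3).filter (fun S => B ⊆ S), wgn M B S =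
      ∑ S ∈ Shadow.shadowLevel M 3 𝒜, ∑ B ∈ 𝒜.filter (fun B => B ⊆ S), wgn M B S := by
    apply Finset.sum_comm'
    intro B S
    simp only [Finset.mem_filter, mem_shadowLevel]
    constructor
    · rintro ⟨hB, hS, hBS⟩
      exact ⟨⟨hB, hBS⟩, hS, B, hB, hBS⟩
    · rintro ⟨⟨hB, hBS⟩, hS, _⟩
      exact ⟨hB, hS, hBS⟩
  have h1 : ∑ B ∈ 𝒜, Profile.price M 2 3 B ≤
      ∑ B ∈ 𝒜, (1 / 3 : ℚ) * ∑ S ∈ (Shadow.levelSet M 3).filter (fun S => B ⊆ S), wgn M B S := by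
    apply Finset.sum_le_sum
    intro B hB
    rw [price_two_three_eq]
    split_ifs with h
    · have := hDem B (h𝒜 hB) h
      linarith
    · exact mul_nonneg (by norm_num) (Finset.sum_nonneg (fun S _ => wgn_nonneg B S))
  have h2 : ∑ S ∈ Shadow.shadowLevel M 3 𝒜, ∑ B ∈ 𝒜.filter (fun B => B ⊆ S), wgn M B S ≤
      ∑ _S ∈ Shadow.shadowLevel M 3 𝒜, (3 : ℚ) := by
    apply Finset.sum_le_sum
    intro S hS
    rw [mem_shadowLevel] at hS
    calc ∑ B ∈ 𝒜.filter (fun B => B ⊆ S), wgn M B S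
        ≤ ∑ B ∈ (Profile.Rq M 2).filter (fun B => B ⊆ S), wgn M B S := by
          apply Finset.sum_le_sum_of_subset_of_nonneg
          · intro B hB
            rw [Finset.mem_filter] at hB ⊢
            exact ⟨h𝒜 hB.1, hB.2⟩
          · intro B _ _
            exact wgn_nonneg B S
      _ ≤ 3 := hCap S hS.1
  rw [Finset.sum_const, nsmul_eq_mul] at h2
  rw [← Finset.mul_sum, hswap] at h1
  linarith

/-- A level above the rank is empty and every price there is `0`: `(H⁺_{q,u})` holds when `ρ(E) < u`. -/
theorem hallIneq_of_eRank_lt {q u : ℕ} (hu : M.eRank < (u : ℕ∞)) : Profile.HallIneq M q u := by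
  intro 𝒜 _
  have hprice : ∀ B ∈ 𝒜, Profile.price M q u B = 0 := by
    intro B _
    unfold Profile.price
    rw [if_neg]
    intro h
    exact absurd (lt_of_le_of_lt (h.trans (M.eRk_le_eRank _)) hu) (lt_irrefl _)
  rw [Finset.sum_eq_zero hprice]
  exact Nat.cast_nonneg _

/-- `(H⁺_{2,3})` on every SIMPLE finite matroid. -/
theorem hallIneq_two_three_of_simple_all (N : Matroid α) [N.Finite]
    (hsimple : ∀ T ⊆ N.E, T.encard ≤ 2 → N.Indep T) : Profile.HallIneq N 2 3 := by
  have hRtop : N.eRank ≠ ⊤ := N.eRank_ne_top_iff.2 inferInstance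
  obtain ⟨R, hRe⟩ := ENat.ne_top_iff_exists.1 hRtop
  rcases Nat.lt_or_ge R 3 with hlt3 | hge3
  · apply hallIneq_of_eRank_lt
    rw [← hRe]; exact_mod_cast hlt3
  rcases Nat.lt_or_ge R 4 with hlt4 | hge4
  · have heq3 : R = 3 := by omega
    exact hallIneq_top (R := 3) (by rw [← hRe, heq3]) 2
  · have hR : (4 : ℕ∞) ≤ N.eRank := by rw [← hRe]; exact_mod_cast hge4
    exact hallIneq_two_three_of_certG (fun S hS => cap_wgn_all hR hsimple hS)
      (fun B hB hp => dem_wgn_all hR hsimple hB hp)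

/-- **`(H⁺_{2,3})` FOR EVERY FINITE MATROID AND EVERY FAMILY** of rank-`2` sets: the row `(2,3)` of the Hall form
C-033, closed by the closed-form local certificate `wgn`. -/
theorem hallIneq_two_three (M : Matroid α) [M.Finite] : Profile.HallIneq M 2 3 :=
  hallIneq_two_three_of_simple (fun N _ hs => hallIneq_two_three_of_simple_all N hs) M

end GenHall

end PercRepro
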